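import Mathlib
import HarnessLib
import Summits.HubbardSuperconductivity.HubbardSuperconductivity.Theorems.KLProgrammeKLRegimeSplitGlueV3

/-!
# Route `KLProgramme` — closer of the K3 glue item `KLRegimeTwoPointLimitGlue` (stmt-HubbardSuperconductivity-19638)

Cell gate-hubbard-kl, seat p3 (any prover; plan g9 12:10:36Z asked for the one-line closer).  The route file's glue statement
`KLRegimeEngine → KLRegimeBetaSplit → KLRegimeCounterterm → KLRegimeTwoPointAssembly → KLRegimeTwoPointLimit` (split rev 9 of crux K3,
children = `EngineP / BetaSplitP / CountertermP / TwoPointAssemblyP klPredsV3 klWindowC` by definition) IS p2's glued strong induction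
`…KLRegimeSplit.KLRegimeInductionV3` (p443267, `KLProgrammeKLRegimeSplitGlueV3.lean`): the children unfold definitionally.
-/

namespace Summit.HubbardSuperconductivity.HubbardSuperconductivity.Theorems

set_option linter.dupNamespace false -- summit = problem name (single-conjunct summit), D-0017

/-- **The K3 glue holds**: the four children of the split imply `KLRegimeTwoPointLimit` (by `KLRegimeSplit.KLRegimeInductionV3`). -/
theorem klRegimeTwoPointLimitGlue_proof :
    Summit.HubbardSuperconductivity.HubbardSuperconductivity.Theses.KLProgramme.KLRegimeTwoPointLimitGlue :=
  fun h₁ h₂ h₃ h₄ => KLRegimeSplit.KLRegimeInductionV3 h₁ h₂ h₃ h₄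

end Summit.HubbardSuperconductivity.HubbardSuperconductivity.Theorems
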